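import Summits.ResolutionOfSingularities.ResolutionOfSingularities.Theorems.PurelyInseparableDim4ChartClosureIdeal
import Literature.AlgebraicGeometry.Resolution.AffinePointBlowupChartTransfer
import HarnessLib

/-!
# Purely inseparable four-folds `z^p + F(x₁, …, x₄)`: the chart centre INSIDE the exceptional divisor — ring level
# (brick S3-glob at depth 2, part A3, case `j ∈ S'`; cell `res-dim4-pi`, typ-2 g4)

[OURS · counted 0] (D-0157 DOOR 2; DR-157-C; desk WORD #97 (c); frame `PIDim4.TerminationImpliesOrderReduction`,
S3 (c)). Sequel of `…ChartClosureIdeal` (A2) for a next coordinate centre `S'` CONTAINING the chart index `j` (the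
centre `V(z, x_{S'})` lies inside the exceptional divisor `x_j = 0` of the `x_j`-chart). With the lift `H` of A2
(`ψ_S(H) = x_j · G`, `G = h(σx)` the twisted cleaning polynomial for `S'`) put `S″ = S' ∖ {j}` and let
`J″ = (z − H, x_k − b_k (k ∈ S″ ∖ S), xᵢ − bᵢ x_j (i ∈ S″ ∩ S))` be the graph ideal of A2/B1 for `S″` (same `H`).
PROVED (no `sorry`, no new axiom):

* `exists_algEquiv_clean_translate` — the automorphism `Ξ₀` (`z ↦ z − G`, `x_k ↦ x_k − b_k` on `S″`) and
  `map_IΛ_clean_translate` — `Ξ₀(z, x_{S″}) = (z − G, x_k − b_k : k ∈ S″) =: I₀″`, hence `I₀″` is prime and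
  `x_j ∉ I₀″` (`isPrime_chartIdeal_erase`, `X_succ_not_mem_chartIdeal_erase`);
* **`coordStrictTransformIdeal_graph_erase_eq`** — `J″^st = I₀″` (the `x_j`-saturation of `ψ(J″)`);
* **`map_clean_coordStrictTransformIdeal_graph_erase_sup`** — `Θ(J″^st) + (x_j) = (z, x_{S'})`: on the re-centred
  chart the strict transform of the graph `Y″ = V(J″)` MEETS THE EXCEPTIONAL DIVISOR exactly in the next centre
  `V(z, x_{S'})`.

Scheme-level use (sequel `…ChartClosureInside`): `E₁ ∩ St_π(Y″)` is a regular snc centre reading `𝓘Λ_{S'}` on the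
chart, and the closure of the chart centre is one of its (disjoint, regular) irreducible components. Nothing here is
a statement about resolution of singularities in dimension ≥ 4 / characteristic `p` (NOT proved anywhere in this
programme). bears_on: LADDER-RESOLUTION:D157-DOOR2 (res-dim4-pi). Supports stmt-ResolutionOfSingularities-16155
(helper, S3-glob A3).
-/

-- every declaration of this summit lives under `Summit.ResolutionOfSingularities.ResolutionOfSingularities`
-- (summit = problem), which the duplicate-namespace linter flags; house convention (cf. the Target file).
set_option linter.dupNamespace false

noncomputable section

open MvPolynomial Finset

open scoped BigOperators

namespace Summit.ResolutionOfSingularities.ResolutionOfSingularities.Theorems.PIDim4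

open Literature.AlgebraicGeometry.Resolution
open Literature.AlgebraicGeometry.Resolution.AffinePointBlowup (A)
open Literature.RingTheory.MvPolynomial (X_mem_span_X_image_iff)

namespace ChartDictionary

variable {K : Type} [Field K] {S S' : Finset (Fin 4)} {j : Fin 4} {b : Fin 4 → K}
  {Θ : A 4 K ≃ₐ[K] A 4 K} {h : MvPolynomial (Fin 4) K}

/-! ## §1 The chart ideal `I₀″ = (z − G, x_k − b_k : k ∈ S″)` is the image of a coordinate ideal -/

/-- **The clean-and-translate automorphism** `Ξ₀`: `z ↦ z − G̃`, `x_k ↦ x_k − b_k` (`k ∈ S″`), the other variables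
fixed (translation by `−b` on `S″`, followed by the dictionary's cleaning-type automorphism `z ↦ z − G̃`). -/
theorem exists_algEquiv_clean_translate (S'' : Finset (Fin 4)) (b : Fin 4 → K) (G : MvPolynomial (Fin 4) K) :
    ∃ Ξ : A 4 K ≃ₐ[K] A 4 K, Ξ (X 0) = X 0 - rename Fin.succ G ∧
      ∀ k : Fin 4, Ξ (X k.succ) = if k ∈ S'' then X k.succ - C (b k) else X k.succ := by
  classical
  obtain ⟨θ, h0, hs⟩ := exists_algEquiv_clean (K := K) (-G)
  refine ⟨(AffinePointBlowup.translateEquiv (Fin.cases 0 fun k => if k ∈ S'' then -b k else 0)).trans θ, ?_, fun k => ?_⟩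
  · change θ (AffinePointBlowup.translateEquiv _ (X 0)) = _
    rw [AffinePointBlowup.translateEquiv_X, Fin.cases_zero, C_0, add_zero, h0, map_neg, sub_eq_add_neg]
  · change θ (AffinePointBlowup.translateEquiv _ (X k.succ)) = _
    rw [AffinePointBlowup.translateEquiv_X, Fin.cases_succ, map_add, hs]
    by_cases hk : k ∈ S''
    · rw [if_pos hk, if_pos hk, C_neg, map_neg, ← sub_eq_add_neg]
      exact congrArg _ (θ.commutes (b k))
    · rw [if_neg hk, if_neg hk, C_0, map_zero, add_zero]

/-- `Ξ₀ (z, x_{S″}) = (z − G̃, x_k − b_k : k ∈ S″)`. -/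
theorem map_IΛ_clean_translate {S'' : Finset (Fin 4)} {G : MvPolynomial (Fin 4) K} {Ξ : A 4 K ≃ₐ[K] A 4 K}
    (hΞ0 : Ξ (X 0) = X 0 - rename Fin.succ G)
    (hΞs : ∀ k : Fin 4, Ξ (X k.succ) = if k ∈ S'' then X k.succ - C (b k) else X k.succ) :
    (AffineCoordBlowup.IΛ 4 K (insert 0 (Fin.succ '' (S'' : Set (Fin 4))))).map (Ξ : A 4 K →+* A 4 K) =
      Ideal.span (insert (X 0 - rename Fin.succ G)
        ((fun k : Fin 4 => (X k.succ - C (b k) : A 4 K)) '' (S'' : Set (Fin 4)))) := by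
  rw [AffineCoordBlowup.IΛ, Ideal.map_span]
  apply le_antisymm
  · rw [Ideal.span_le]
    rintro _ ⟨_, ⟨l, hl, rfl⟩, rfl⟩
    rcases hl with rfl | ⟨k, hk, rfl⟩
    · rw [SetLike.mem_coe, RingHom.coe_coe, hΞ0]
      exact Ideal.subset_span (Set.mem_insert _ _)
    · rw [SetLike.mem_coe, RingHom.coe_coe, hΞs k, if_pos (Finset.mem_coe.mp hk)]
      exact Ideal.subset_span (Set.mem_insert_of_mem _ ⟨k, hk, rfl⟩)
  · rw [Ideal.span_le]
    rintro g (rfl | ⟨k, hk, rfl⟩)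
    · rw [SetLike.mem_coe, ← hΞ0]
      exact Ideal.subset_span ⟨X 0, ⟨0, Set.mem_insert _ _, rfl⟩, rfl⟩
    · have h1 : (X k.succ - C (b k) : A 4 K) = (Ξ : A 4 K →+* A 4 K) (X k.succ) := by
        rw [RingHom.coe_coe, hΞs k, if_pos (Finset.mem_coe.mp hk)]
      show (X k.succ - C (b k) : A 4 K) ∈ _
      rw [h1]
      exact Ideal.subset_span ⟨X k.succ, ⟨k.succ, Set.mem_insert_of_mem _ ⟨k, hk, rfl⟩, rfl⟩, rfl⟩

/-- **The chart ideal `I₀″` is prime.** -/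
theorem isPrime_chartIdeal (S'' : Finset (Fin 4)) (b : Fin 4 → K) (G : MvPolynomial (Fin 4) K) :
    (Ideal.span (insert (X 0 - rename Fin.succ G)
        ((fun k : Fin 4 => (X k.succ - C (b k) : A 4 K)) '' (S'' : Set (Fin 4))))).IsPrime := by
  obtain ⟨Ξ, hΞ0, hΞs⟩ := exists_algEquiv_clean_translate S'' b G
  rw [← map_IΛ_clean_translate hΞ0 hΞs]
  haveI := AffineCoordBlowup.isPrime_IΛ 4 K (insert 0 (Fin.succ '' (S'' : Set (Fin 4))))
  exact Ideal.map_isPrime_of_equiv Ξ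

/-- **`x_j ∉ I₀″`** for `j ∉ S″`. -/
theorem X_succ_not_mem_chartIdeal {S'' : Finset (Fin 4)} (hjS'' : j ∉ S'') (b : Fin 4 → K)
    (G : MvPolynomial (Fin 4) K) :
    (X j.succ : A 4 K) ∉ Ideal.span (insert (X 0 - rename Fin.succ G)
        ((fun k : Fin 4 => (X k.succ - C (b k) : A 4 K)) '' (S'' : Set (Fin 4)))) := by
  obtain ⟨Ξ, hΞ0, hΞs⟩ := exists_algEquiv_clean_translate S'' b G
  rw [← map_IΛ_clean_translate hΞ0 hΞs]
  have hc : (Ξ : A 4 K →+* A 4 K) = ((Ξ.toRingEquiv : A 4 K ≃+* A 4 K) : A 4 K →+* A 4 K) := RingHom.ext fun x => rfl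
  rw [hc, Ideal.map_comap_of_equiv, Ideal.mem_comap]
  have hfix : Ξ.toRingEquiv.symm (X j.succ) = X j.succ := by
    rw [RingEquiv.symm_apply_eq]
    change X j.succ = Ξ (X j.succ)
    rw [hΞs j, if_neg hjS'']
  rw [hfix]
  exact X_succ_not_mem_IΛ hjS''

/-! ## §2 The strict transform of the graph `Y″` for `S″ = S' ∖ {j}`, read on the re-centred chart -/

/-- **`J″^st = I₀″`**: the `x_j`-saturation of the total transform `ψ(J″)` of the graph ideal
`J″ = (z − H, x_k − b_k (k ∈ S″ ∖ S), xᵢ − bᵢ x_j (i ∈ S″ ∩ S))` (`ψ_S(H) = x_j G`, `j ∉ S″`) is the chart ideal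
`I₀″ = (z − G̃, x_k − b_k : k ∈ S″)`. -/
theorem coordStrictTransformIdeal_graph_eq {S'' : Finset (Fin 4)} (hjS'' : j ∉ S'')
    {H G : MvPolynomial (Fin 4) K} (hH : coordBlowupSubst K (S : Set (Fin 4)) j H = X j * G) :
    coordStrictTransformIdeal K (insert 0 (Fin.succ '' (S : Set (Fin 4)))) j.succ
      (Ideal.span (insert (X 0 - rename Fin.succ H)
        (((fun k : Fin 4 => (X k.succ - C (b k) : A 4 K)) '' ((S'' \ S : Finset (Fin 4)) : Set (Fin 4))) ∪
         ((fun i : Fin 4 => (X i.succ - C (b i) * X j.succ : A 4 K)) '' ((S'' ∩ S : Finset (Fin 4)) : Set (Fin 4)))))) =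
      Ideal.span (insert (X 0 - rename Fin.succ G)
        ((fun k : Fin 4 => (X k.succ - C (b k) : A 4 K)) '' (S'' : Set (Fin 4)))) := by
  classical
  set Λ : Set (Fin (4 + 1)) := insert 0 (Fin.succ '' (S : Set (Fin 4))) with hΛ
  set I₀ := Ideal.span (insert (X 0 - rename Fin.succ G)
        ((fun k : Fin 4 => (X k.succ - C (b k) : A 4 K)) '' (S'' : Set (Fin 4)))) with hI₀
  set gens : Set (A 4 K) := insert (X 0 - rename Fin.succ H)
        (((fun k : Fin 4 => (X k.succ - C (b k) : A 4 K)) '' ((S'' \ S : Finset (Fin 4)) : Set (Fin 4))) ∪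
         ((fun i : Fin 4 => (X i.succ - C (b i) * X j.succ : A 4 K)) '' ((S'' ∩ S : Finset (Fin 4)) : Set (Fin 4))))
    with hgens
  have hprime : I₀.IsPrime := isPrime_chartIdeal S'' b G
  have hxj : (X j.succ : A 4 K) ∉ I₀ := X_succ_not_mem_chartIdeal hjS'' b G
  -- `ψ` carries every generator of `J″` into `I₀″` (times `x_j` or not)
  have hgen : ∀ g ∈ gens, coordBlowupSubst K Λ j.succ g ∈ I₀ := by
    intro g hg
    rcases hg with rfl | ⟨k, hk, rfl⟩ | ⟨i, hi, rfl⟩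
    · rw [coordBlowupSubst_X_zero_sub_lift hH]
      exact Ideal.mul_mem_left _ _ (Ideal.subset_span (Set.mem_insert _ _))
    · obtain ⟨hkS'', hkS⟩ := Finset.mem_sdiff.mp (Finset.mem_coe.mp hk)
      rw [coordBlowupSubst_X_sub_C_of_not_mem hkS]
      exact Ideal.subset_span (Set.mem_insert_of_mem _ ⟨k, Finset.mem_coe.mpr hkS'', rfl⟩)
    · obtain ⟨hiS'', hiS⟩ := Finset.mem_inter.mp (Finset.mem_coe.mp hi)
      have hij : i ≠ j := fun e => hjS'' (e ▸ hiS'')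
      rw [coordBlowupSubst_X_sub_C_mul hiS hij]
      exact Ideal.mul_mem_left _ _ (Ideal.subset_span (Set.mem_insert_of_mem _ ⟨i, Finset.mem_coe.mpr hiS'', rfl⟩))
  have htot : (Ideal.span gens).map (coordBlowupSubst K Λ j.succ : A 4 K →+* A 4 K) ≤ I₀ := by
    rw [Ideal.map_span, Ideal.span_le]
    rintro _ ⟨g, hg, rfl⟩
    exact hgen g hg
  apply le_antisymm
  · rintro f ⟨N, hN⟩
    have h1 : X j.succ ^ N * f ∈ I₀ := htot hN
    rcases hprime.mem_or_mem h1 with h2 | h2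
    · exact absurd (hprime.mem_of_pow_mem N h2) hxj
    · exact h2
  · rw [hI₀, Ideal.span_le]
    rintro g (rfl | ⟨k, hk, rfl⟩)
    · refine mem_of_X_mul_mem K Λ j.succ ?_
      rw [← coordBlowupSubst_X_zero_sub_lift hH]
      exact coordBlowupSubst_mem K Λ j.succ (Ideal.subset_span (Set.mem_insert _ _))
    · have hk : k ∈ S'' := Finset.mem_coe.mp hk
      by_cases hkS : k ∈ S
      · have hkj : k ≠ j := fun e => hjS'' (e ▸ hk)
        show (X k.succ - C (b k) : A 4 K) ∈ _
        refine mem_of_X_mul_mem K Λ j.succ ?_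
        rw [← coordBlowupSubst_X_sub_C_mul hkS hkj]
        exact coordBlowupSubst_mem K Λ j.succ (Ideal.subset_span (Set.mem_insert_of_mem _
          (Or.inr ⟨k, Finset.mem_coe.mpr (Finset.mem_inter.mpr ⟨hk, hkS⟩), rfl⟩)))
      · have h1 := coordBlowupSubst_mem K Λ j.succ (I := Ideal.span gens) (Ideal.subset_span
          (Set.mem_insert_of_mem _ (Or.inl ⟨k, Finset.mem_coe.mpr (Finset.mem_sdiff.mpr ⟨hk, hkS⟩), rfl⟩)))
        show (X k.succ - C (b k) : A 4 K) ∈ _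
        rw [coordBlowupSubst_X_sub_C_of_not_mem hkS] at h1
        exact h1

/-- **Θ(J″^st) + (x_j) = (z, x_{S'})` for `S' = S″ ∪ {j}`, `j ∉ S″`**: on the re-centred chart the strict transform
of the graph `Y″` meets the exceptional divisor `x_j = 0` exactly in the next centre `V(z, x_{S'})` (`G = h(σx)` the
twisted cleaning polynomial FOR `S'`, so that `Θ(z − G̃) = z + (h − h|_{x_{S'}=0})`). -/
theorem map_clean_coordStrictTransformIdeal_graph_erase_sup (hjS' : j ∈ S') (hbj : b j = 0)
    (h0 : Θ (X 0) = X 0 + rename Fin.succ h) (hs : ∀ i : Fin 4, Θ (X i.succ) = X i.succ + C (b i))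
    {H : MvPolynomial (Fin 4) K} (hH : coordBlowupSubst K (S : Set (Fin 4)) j H =
      X j * aeval (fun k => if k ∈ S' then (0 : MvPolynomial (Fin 4) K) else X k - C (b k)) h) :
    (coordStrictTransformIdeal K (insert 0 (Fin.succ '' (S : Set (Fin 4)))) j.succ
      (Ideal.span (insert (X 0 - rename Fin.succ H)
        (((fun k : Fin 4 => (X k.succ - C (b k) : A 4 K)) '' ((S'.erase j \ S : Finset (Fin 4)) : Set (Fin 4))) ∪
         ((fun i : Fin 4 => (X i.succ - C (b i) * X j.succ : A 4 K)) ''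
           ((S'.erase j ∩ S : Finset (Fin 4)) : Set (Fin 4))))))).map (Θ : A 4 K →+* A 4 K) ⊔
      Ideal.span {(X j.succ : A 4 K)} =
      AffineCoordBlowup.IΛ 4 K (insert 0 (Fin.succ '' (S' : Set (Fin 4)))) := by
  classical
  have hjS'' : j ∉ S'.erase j := Finset.notMem_erase j S'
  rw [coordStrictTransformIdeal_graph_eq hjS'' hH, Ideal.map_span]
  have hΘC : ∀ c : K, Θ (C c) = C c := fun c => Θ.commutes c
  have hz : Θ (X 0 - rename Fin.succ (aeval (fun k => if k ∈ S' then (0 : MvPolynomial (Fin 4) K) else X k - C (b k)) h)) =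
      X 0 + rename Fin.succ (h - aeval (fun k => if k ∈ S' then (0 : MvPolynomial (Fin 4) K) else X k) h) :=
    clean_X_zero_sub_twist h0 hs
  apply le_antisymm
  · rw [sup_le_iff, Ideal.span_le, Ideal.span_le, Set.singleton_subset_iff]
    refine ⟨?_, Ideal.subset_span ⟨j.succ, Set.mem_insert_of_mem _ ⟨j, hjS', rfl⟩, rfl⟩⟩
    rintro _ ⟨g, hg, rfl⟩
    rcases hg with rfl | ⟨k, hk, rfl⟩
    · rw [SetLike.mem_coe, RingHom.coe_coe, hz]
      exact X_zero_add_rename_sub_mem_IΛ S' h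
    · have hkS' : k ∈ S' := Finset.mem_of_mem_erase (Finset.mem_coe.mp hk)
      rw [SetLike.mem_coe, RingHom.coe_coe, map_sub, hs k, hΘC, add_sub_cancel_right]
      exact Ideal.subset_span ⟨k.succ, Set.mem_insert_of_mem _ ⟨k, hkS', rfl⟩, rfl⟩
  · -- every generator `x_k` (`k ∈ S'`) and `z` of `(z, x_{S'})`
    have hXk : ∀ k ∈ S', (X k.succ : A 4 K) ∈
        Ideal.span ((Θ : A 4 K →+* A 4 K) '' insert (X 0 - rename Fin.succ
          (aeval (fun k => if k ∈ S' then (0 : MvPolynomial (Fin 4) K) else X k - C (b k)) h))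
          ((fun k : Fin 4 => (X k.succ - C (b k) : A 4 K)) '' ((S'.erase j : Finset (Fin 4)) : Set (Fin 4)))) ⊔
        Ideal.span {(X j.succ : A 4 K)} := by
      intro k hk
      by_cases hkj : k = j
      · subst hkj
        exact Ideal.mem_sup_right (Ideal.mem_span_singleton_self _)
      · refine Ideal.mem_sup_left (Ideal.subset_span ⟨X k.succ - C (b k), Set.mem_insert_of_mem _
          ⟨k, Finset.mem_coe.mpr (Finset.mem_erase.mpr ⟨hkj, hk⟩), rfl⟩, ?_⟩)
        rw [RingHom.coe_coe, map_sub, hs k, hΘC, add_sub_cancel_right]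
    have hspan : (Ideal.span (X '' (S' : Set (Fin 4)) : Set (MvPolynomial (Fin 4) K))).map
        (rename Fin.succ : MvPolynomial (Fin 4) K →ₐ[K] A 4 K) ≤
        Ideal.span ((Θ : A 4 K →+* A 4 K) '' insert (X 0 - rename Fin.succ
          (aeval (fun k => if k ∈ S' then (0 : MvPolynomial (Fin 4) K) else X k - C (b k)) h))
          ((fun k : Fin 4 => (X k.succ - C (b k) : A 4 K)) '' ((S'.erase j : Finset (Fin 4)) : Set (Fin 4)))) ⊔
        Ideal.span {(X j.succ : A 4 K)} := by
      rw [Ideal.map_span, Ideal.span_le]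
      rintro _ ⟨_, ⟨k, hk, rfl⟩, rfl⟩
      rw [SetLike.mem_coe, rename_X]
      exact hXk k (Finset.mem_coe.mp hk)
    rw [AffineCoordBlowup.IΛ, Ideal.span_le]
    rintro _ ⟨l, hl, rfl⟩
    rcases hl with rfl | ⟨k, hk, rfl⟩
    · have h2 : X 0 + rename Fin.succ (h - aeval (fun k => if k ∈ S' then (0 : MvPolynomial (Fin 4) K) else X k) h) ∈
          Ideal.span ((Θ : A 4 K →+* A 4 K) '' insert (X 0 - rename Fin.succ
            (aeval (fun k => if k ∈ S' then (0 : MvPolynomial (Fin 4) K) else X k - C (b k)) h))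
            ((fun k : Fin 4 => (X k.succ - C (b k) : A 4 K)) '' ((S'.erase j : Finset (Fin 4)) : Set (Fin 4)))) ⊔
          Ideal.span {(X j.succ : A 4 K)} :=
        Ideal.mem_sup_left (Ideal.subset_span ⟨_, Set.mem_insert _ _, hz⟩)
      have h3 := hspan (Ideal.mem_map_of_mem _ (sub_aeval_mem_span_X_image S' h))
      have h5 := Ideal.sub_mem _ h2 h3
      rwa [add_sub_cancel_right] at h5
    · exact hXk k (Finset.mem_coe.mp hk)

end ChartDictionary

end Summit.ResolutionOfSingularities.ResolutionOfSingularities.Theorems.PIDim4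

end
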